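import Literature.Claims.NS.ClayR3BKMBridge
import Mathlib.InformationTheory.KullbackLeibler.Basic
import Mathlib.MeasureTheory.Constructions.HaarToSphere
import Mathlib.Analysis.Calculus.BumpFunction.Normed
import HarnessLib

/-!
# Claim skeleton (D-0090 NS-CLAIMS, C147): Bachani 2026 — «A Deterministic Entropy Barrier
# Preventing Finite-Time Blowup in the 3D Navier-Stokes Equations»

Typed skeleton of Suhail Hiro Bachani, *A Deterministic Entropy Barrier Preventing Finite-Time
Blowup in the 3D Navier-Stokes Equations*, Zenodo record 18139822 (concept doi
10.5281/zenodo.18139821; created 2026-01-14; single file «ARMA-D-25-00655 (1).pdf», an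
Editorial-Manager submission rendering — PDF p.1 is the submission cover sheet; the deposit is the
author's manuscript as submitted, no journal decision is printed; PDF sha16 `b3badc443f6f2caa`, 12
pp.; PRINTED page = PDF page − 1) = bib `Bachani2026`, text of record of cell `ns-claims` row C147
(RULINGS v1.35 (5); census pin `run/shared/lean/pub/ns-claims/census/texts/Bachani2026/`, pages
`pNNN.txt` = PDF page NNN; locators below are «printed p.N = pages/p(N+1).txt l.M», line numbers of
the text layer). UNREFEREED CLAIM under adjudication — NOTHING in this file asserts a step of the
paper: the paper's statements are `def … : Prop`; the `theorem`s are kernel compositions of the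
paper's own implications, the Clay identification and small classical facts. Verdict vocabulary
is the refuter's / referee's.

## The claimed statement, as printed
Abstract p.1 l.10–17: «We prove that smooth solutions of the three-dimensional incompressible
Navier-Stokes equations with finite enstrophy cannot develop finite-time singularities. …»
Theorem 7.1 p.9 l.4–5: «Theorem 7.1 (Global Regularity). Let u₀ ∈ H¹(ℝ³) be divergence-free.
Then the corresponding Navier-Stokes solution is globally smooth.» Proof p.9 l.6–10: «Suppose for
contradiction that blowup occurs at T* < ∞. (7) By Lemma 5.1, alignment collapses: A → √(2/3) on
vanishing scales. (8) By Corollary 4.2, entropy collapses: Sᵣ(t) → 0 as t → T*. (9) By Lemma 6.2,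
Sᵣ(t) ≥ c* > 0 for all t. (10) Contradiction. □»

## Architecture of the printed argument and the typed Steps (print order)
§2 p.3: `ω = curl u`, `ω̂ = ω/|ω|` where `|ω| ≠ 0`; for «a mollifier ρᵣ with support of scale r»
the local direction probability measure `μ_{r,x}(dn) = [∫ρᵣ(x−y)|ω(y)|²δ_{ω̂(y)}(dn)dy]/[∫ρᵣ(x−y)|ω(y)|²dy]`
(`Mollifier`, `weight`, `dirMeasure`). §3 p.4: Def 3.1 `ℋᵣ(x) = ∫_{S²} f log(4πf) dn`, `f` the
density of `μ_{r,x}` w.r.t. the uniform measure on `S²` — i.e. the relative entropy of `μ_{r,x}`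
versus the uniform probability measure (`locEntropy`, Mathlib `klDiv`, valued in `[0,∞]`: `+∞` when
`μ_{r,x}` has no density, e.g. a locally constant direction field); Def 3.2
`Sᵣ(t) = ∫ ℋᵣ(x,t)[∫ρᵣ(x−y)|ω(y,t)|²dy]dx` (`globEntropy`); Lemma 3.3 (i) `Sᵣ ≥ 0` (automatic in
`[0,∞]`, `lemma33i`), (ii) «`Sᵣ(t) = 0` iff directions are perfectly aligned locally a.e.»
(`Step_L33ii`; typist's flag: SUSPICIOUS — a relative entropy versus the uniform measure vanishes
iff the measure IS uniform and is `+∞` at a Dirac mass), (iii) continuity in `t` (`Step_L33iii`).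
§4 p.5: Lemma 4.1 `ℋᵣ(x) ≤ c₁(1 − λ₁(Mᵣ(x)))|log(1 − λ₁)|`, `Mᵣ(x) = ∫ n⊗n μ_{r,x}(dn)`, `λ₁` its
largest eigenvalue (`alignTensor`, `lam1`, `Step_L41`; flag: SUSPICIOUS, same inversion — `c₂` is
printed and unused; ABSTRACT COMPANION at the display grain for zonal laws `Step_L41zonal`,
`IsZonalDensity`/`zonalEntropy`/`zonalLam1`, TYPING-HYGIENE 13); Cor 4.2 «if `A(Mᵣ(x)) → √(2/3)` (the maximum anisotropy) then `ℋᵣ(x) → 0`»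
(`Step_C42`; `A` is NOT defined in print — typed as the deviatoric Frobenius norm `anis`, the
standard anisotropy with maximum `√(2/3)` at rank one, trace one). §5 p.6: Lemma 5.1 «if a smooth
solution blows up at `T* < ∞` then there exist `(xₙ,tₙ,rₙ)`, `rₙ → 0`, with
`A(M_{rₙ}(xₙ,tₙ)) → √(2/3)`» (`Step_L51`; blow-up-conditional), its stage (1) BKM (`Step_L51s1`)
and stage (6) «M → rank-1, hence A → √(2/3)» (`Step_L51s6`, linear algebra). §6 p.7: the direction
equation (6.1, not typed separately), Prop 6.1 `dSᵣ/dt = ν𝒟ᵣ(t) − ℰᵣ(t)`,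
`𝒟ᵣ = ∫|∇ω̂|²|ω|²ρᵣ dx ≥ 0`, `|ℰᵣ(t)| ≤ C r⁻¹∫|ω|²` (`dissip`, `Step_P61`; the text layer prints
the glyph `⊗` for `𝒟`/`∇`/`≪` on this page), **Lemma 6.2 (Quantitative Entropy Barrier) «there exist
`r* > 0` and `c* > 0` such that if `S_{r*}(t) ≤ c*` then `dS_{r*}/dt > 0`»** (`Step_L62`) with its
proof Steps 1–4 (`Step_L62s1` … `Step_L62s4`). §7 p.9: Thm 7.1 and the proof lines (8) (`Step_8`:
from alignment collapse on vanishing scales to `Sᵣ(t) → 0` as `t → T*` at EVERY fixed scale — the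
passage from Cor 4.2 (pointwise, `rₙ → 0`) to the global entropy at fixed `r` is not printed) and
(9) (`Step_9`: «`Sᵣ(t) ≥ c* > 0` for all `t`», the content consumed by (10); its printed
derivation «by Lemma 6.2» is the implication `Step_9_of_L62`). Step 0 (`Step0_maximal`): «the
corresponding Navier–Stokes solution» / «suppose blowup occurs at T* < ∞» — the maximal smooth
solution (implicit; classical for the smooth sub-face). COMPOSITION `claim_of_steps` (PROVED):
`Step0_maximal → Step_L51 → Step_8 → Step_9 → ClaimedTheorem`, at any fixed mollifier.

## Typing conventions (cell TYPING-HYGIENE)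
* Data/solution class. Print: «u₀ ∈ H¹(ℝ³) divergence-free», «smooth solutions … with finite
  enstrophy». Typed class `IsSol ν u₀ T u p`: classical solution of the unforced system on
  `ℝ³ × [0,T)` (tree `IsClassicalNSSolutionOn (Ico 0 T)`), `u 0 = u₀` with `u₀ ∈ C^∞ ∩ H¹`
  divergence-free (`IsDatum`: smooth, `∫|u₀|² < ∞`, `∫|∇u₀|² < ∞`), energy bounded on `[0,T)`
  (Leray's class; «the corresponding Navier–Stokes solution»). The SMOOTH sub-face of «u₀ ∈ H¹» is
  typed (the paper's objects — smooth solutions from `t = 0`, Lemma 3.3 (iii) — presuppose it);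
  TODO(general form): rough `H¹` data (smooth for `t > 0`). `ClaimedTheorem` = existence of a
  global smooth solution in this class for every such datum; `clay_of_claimed` PROVED (Clay data
  are smooth `H¹` data; the tree's blow-up alternative `clayR3_solvable_or_supBlowup`).
* Functionals: `ℋᵣ`, `Sᵣ` are `ℝ≥0∞`-valued (relative entropy may be `+∞`); thresholds `ε`, `c*`
  enter as `ENNReal.ofReal`; time derivatives are taken of the real shadow `(Sᵣ).toReal` within
  `[0,T)` (`timeDerivR`; junk where `Sᵣ = ∞` — flagged, not repaired). `μ_{r,x}` is normalised by
  `W⁻¹` in `ℝ≥0∞` (junk where the local enstrophy weight `W` vanishes; every Step that divides by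
  `W` carries `0 < W` explicitly). No `sSup` over solutions; `λ₁` is a supremum over the compact
  unit sphere of a quadratic form (attained). The mollifier is generic in print («a mollifier ρᵣ
  with support of scale r»): every Step is quantified over `Mollifier`s; `stdMollifier` (normed
  bump, PROVED admissible) witnesses non-emptiness and is the instance of the compositions.
* Constants printed bare (`c₁`, `C`, `c`, `r*`, `c*`) are existentially quantified BEFORE the
  solution and the time, AFTER `ν` where the printed choice depends on `ν` (Lemma 6.2 Step 4:
  `r* < νcε⁻¹/C`), as printed.

Cell files: `claims/Bachani2026/CARD.md` (typist-7 g6; PREDICTION sealed 2026-08-27T10:20Z, sha16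
4a9a36e88362d35c). WHAT THIS IS NOT: not a claim about NS regularity or blow-up; not a claim about
any author beyond the typed locator.
-/

noncomputable section

open MeasureTheory Set Filter Topology
open scoped ENNReal NNReal ContDiff

namespace Literature.Claims.NS.Bachani2026

open Literature.Analysis.FluidPDE Literature.Claims.NS.ClayVariants InformationTheory

/-! ## Vocabulary -/

/-- Physical space `ℝ³`. [folklore] -/
abbrev E3 : Type := EuclideanSpace ℝ (Fin 3)

/-- The unit sphere `S²` of directions. [cite: Bachani2026, §2.1 p.3 l.5–6] -/
abbrev S2 : Type := Metric.sphere (0 : E3) 1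

/-- «a mollifier ρᵣ with support of scale r» (§2.2 p.3 l.8): for every `r > 0` a smooth
nonnegative kernel supported in the ball of radius `r`, of unit mass. [cite: Bachani2026, §2.2 p.3 l.8] -/
structure Mollifier where
  /-- the kernel at scale `r` -/
  ρ : ℝ → E3 → ℝ
  smooth : ∀ r, 0 < r → ContDiff ℝ ∞ (ρ r)
  nonneg : ∀ r y, 0 ≤ ρ r y
  support : ∀ r, 0 < r → ∀ y : E3, r ≤ ‖y‖ → ρ r y = 0
  mass : ∀ r, 0 < r → ∫ y, ρ r y = 1

/-- The direction field `ω̂ = ω/|ω|` (§2.1 p.3 l.5; value `0` where `ω = 0`, never used there).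
[cite: Bachani2026, §2.1 p.3 l.5–6] -/
def dir (w : E3 → E3) (y : E3) : E3 := ‖w y‖⁻¹ • w y

/-- The direction map into `S²` (a fixed pole at zeros of `ω`; those points carry no weight in
`μ_{r,x}`). [cite: Bachani2026, §2.1–2.2 p.3 l.5–9] -/
def dirS (w : E3 → E3) (y : E3) : S2 :=
  if h : w y = 0 then ⟨EuclideanSpace.single 2 1, by simp⟩
  else ⟨‖w y‖⁻¹ • w y, by
    rw [mem_sphere_zero_iff_norm, norm_smul, norm_inv, norm_norm,
      inv_mul_cancel₀ (norm_ne_zero_iff.2 h)]⟩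

/-- The local enstrophy weight `Wᵣ(x) = ∫ ρᵣ(x−y)|ω(y)|² dy` (the denominator of `μ_{r,x}` and the
weight in `Sᵣ`). [cite: Bachani2026, §2.2 p.3 l.9; Def 3.2 p.4 l.10] -/
def weight (ρ : Mollifier) (r : ℝ) (w : E3 → E3) (x : E3) : ℝ :=
  ∫ y, ρ.ρ r (x - y) * ‖w y‖ ^ 2

/-- The same weight as an extended nonnegative real. [cite: Bachani2026, §2.2 p.3 l.9] -/
def eweight (ρ : Mollifier) (r : ℝ) (w : E3 → E3) (x : E3) : ℝ≥0∞ :=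
  ∫⁻ y, ENNReal.ofReal (ρ.ρ r (x - y) * ‖w y‖ ^ 2)

/-- **The local direction probability measure `μ_{r,x}`** (§2.2 p.3 l.9): the push-forward under
`ω̂` of `ρᵣ(x−y)|ω(y)|² dy`, normalised by `Wᵣ(x)`. [cite: Bachani2026, §2.2 p.3 l.8–11] -/
def dirMeasure (ρ : Mollifier) (r : ℝ) (w : E3 → E3) (x : E3) : Measure S2 :=
  (eweight ρ r w x)⁻¹ •
    ((volume : Measure E3).withDensity (fun y => ENNReal.ofReal (ρ.ρ r (x - y) * ‖w y‖ ^ 2))).map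
      (dirS w)

/-- The uniform probability measure on `S²` (the normalised spherical part of Lebesgue measure).
[cite: Bachani2026, Def 3.1 p.4 l.5–8] -/
def unifS2 : Measure S2 :=
  ((volume : Measure E3).toSphere univ)⁻¹ • (volume : Measure E3).toSphere

/-- **Definition 3.1 (local alignment entropy)** `ℋᵣ(x) = ∫_{S²} f_{r,x} log(4π f_{r,x}) dn`, `f_{r,x}`
the density of `μ_{r,x}` with respect to the uniform measure on `S²` — the relative entropy of
`μ_{r,x}` versus the uniform probability measure (Mathlib `klDiv`; `+∞` where no density exists).
[cite: Bachani2026, Def 3.1 p.4 l.5–8] -/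
def locEntropy (ρ : Mollifier) (r : ℝ) (w : E3 → E3) (x : E3) : ℝ≥0∞ :=
  klDiv (dirMeasure ρ r w x) unifS2

/-- **Definition 3.2 (global alignment entropy)** `Sᵣ = ∫ ℋᵣ(x) [∫ρᵣ(x−y)|ω(y)|²dy] dx`.
[cite: Bachani2026, Def 3.2 p.4 l.9–10] -/
def globEntropy (ρ : Mollifier) (r : ℝ) (w : E3 → E3) : ℝ≥0∞ :=
  ∫⁻ x, locEntropy ρ r w x * eweight ρ r w x

/-- The real shadow of `Sᵣ` (for the calculus statements of §6). [cite: Bachani2026, Def 3.2 p.4 l.9–10] -/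
def globEntropyR (ρ : Mollifier) (r : ℝ) (w : E3 → E3) : ℝ := (globEntropy ρ r w).toReal

/-- `Sᵣ(t)` along a velocity field `u`: the entropy of `ω(t) = curl u(t)`.
[cite: Bachani2026, Def 3.2 p.4 l.9–10] -/
def St (ρ : Mollifier) (r : ℝ) (u : ℝ → E3 → E3) (t : ℝ) : ℝ≥0∞ := globEntropy ρ r (curl (u t))

/-- `dSᵣ/dt` within `[0,T)` (one-sided at `t = 0`), of the real shadow.
[cite: Bachani2026, Prop 6.1 p.7 l.10–11] -/
def dSdt (ρ : Mollifier) (r T : ℝ) (u : ℝ → E3 → E3) (t : ℝ) : ℝ :=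
  derivWithin (fun s => globEntropyR ρ r (curl (u s))) (Ico 0 T) t

/-- **The local alignment tensor `Mᵣ(x) = ∫ n⊗n μ_{r,x}(dn)`** `= Wᵣ(x)⁻¹∫ρᵣ(x−y) ω(y)⊗ω(y) dy`
(Lemma 4.1 p.5 l.4–5). [cite: Bachani2026, Lemma 4.1 p.5 l.4–5] -/
def alignTensor (ρ : Mollifier) (r : ℝ) (w : E3 → E3) (x : E3) : Matrix (Fin 3) (Fin 3) ℝ :=
  fun i j => (weight ρ r w x)⁻¹ * ∫ y, ρ.ρ r (x - y) * ((w y) i * (w y) j)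

/-- The quadratic form `vᵀMv` of the alignment tensor (Lemma 4.1 p.5 l.4–7). [cite: Bachani2026, Lemma 4.1 p.5 l.4–7] -/
def qform (M : Matrix (Fin 3) (Fin 3) ℝ) (v : E3) : ℝ := ∑ i, ∑ j, v i * M i j * v j

/-- `λ₁(M)` = the largest eigenvalue of the (symmetric) alignment tensor, as the maximum of its
quadratic form on unit vectors. [cite: Bachani2026, Lemma 4.1 p.5 l.7] -/
def lam1 (M : Matrix (Fin 3) (Fin 3) ℝ) : ℝ := ⨆ v : S2, qform M (v : E3)

/-- `A(M)` — «the anisotropy», maximum `√(2/3)` (Cor 4.2 p.5 l.11; NOT defined in print): typed as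
the Frobenius norm of the deviator `M − I/3`, which for `tr M = 1` is maximal, `= √(2/3)`, exactly
at rank one. [cite: Bachani2026, Cor 4.2 p.5 l.11; Lemma 5.1 p.6 l.7] -/
def anis (M : Matrix (Fin 3) (Fin 3) ℝ) : ℝ :=
  Real.sqrt (∑ i, ∑ j, (M i j - (if i = j then (1 / 3 : ℝ) else 0)) ^ 2)

/-- `|∇ω̂|²(y)` (Hilbert–Schmidt square of the gradient of the direction field; `0` at zeros of `ω`,
where `ω̂` is undefined). [cite: Bachani2026, §6.1 p.7 l.5–8; Prop 6.1 p.7 l.12] -/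
def dirGradSq (w : E3 → E3) (y : E3) : ℝ :=
  if w y = 0 then 0 else ∑ i : Fin 3, ‖fderiv ℝ (dir w) y (EuclideanSpace.single i 1)‖ ^ 2

/-- **`𝒟ᵣ = ∫ |∇ω̂|²|ω|² ρᵣ dx ≥ 0`**, the viscous (angular) dissipation term of Prop 6.1 (p.7 l.12;
typed literally as the mollified integral `∫∫ρᵣ(x−y)|∇ω̂(y)|²|ω(y)|² dy dx`).
[cite: Bachani2026, Prop 6.1 p.7 l.12] -/
def dissip (ρ : Mollifier) (r : ℝ) (w : E3 → E3) : ℝ :=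
  ∫ x, ∫ y, ρ.ρ r (x - y) * (dirGradSq w y * ‖w y‖ ^ 2)

/-- `∫|ω|² dx` (twice the enstrophy). [cite: Bachani2026, Prop 6.1 p.7 l.12–13] -/
def ensq (w : E3 → E3) : ℝ := ∫ x, ‖w x‖ ^ 2

/-! ### A mollifier exists (normed bump) — the instance of the compositions -/

/-- The normed smooth bump of outer radius `r` (inner radius `r/2`), for `r > 0` — a mollifier «with support of scale r». [cite: Bachani2026, §2.2 p.3 l.8] -/
def stdBump (r : ℝ) (hr : 0 < r) : ContDiffBump (0 : E3) := ⟨r / 2, r, by positivity, by linarith⟩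

/-- The kernel of the standard mollifier (junk: the unit bump for `r ≤ 0`). [cite: Bachani2026, §2.2 p.3 l.8] -/
def stdKernel (r : ℝ) : E3 → ℝ :=
  if hr : 0 < r then (stdBump r hr).normed volume else (stdBump 1 one_pos).normed volume

/-- The standard mollifier: smooth, nonnegative, supported in `B(0,r)`, unit mass.
[cite: Bachani2026, §2.2 p.3 l.8] -/
def stdMollifier : Mollifier where
  ρ := stdKernel
  smooth r hr := by
    simp only [stdKernel, dif_pos hr]
    exact (stdBump r hr).contDiff_normed (n := ⊤)
  nonneg r y := by
    unfold stdKernel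
    split_ifs <;> exact ContDiffBump.nonneg_normed _ _
  support r hr y hy := by
    simp only [stdKernel, dif_pos hr]
    have h : y ∉ Function.support ((stdBump r hr).normed volume) := by
      rw [ContDiffBump.support_normed_eq]
      simp only [Metric.mem_ball, dist_zero_right, not_lt]
      exact hy
    exact Function.notMem_support.mp h
  mass r hr := by
    simp only [stdKernel, dif_pos hr]
    exact (stdBump r hr).integral_normed

/-! ## The class the argument runs in -/

/-- «u₀ ∈ H¹(ℝ³) divergence-free» (Thm 7.1), smooth sub-face: `u₀ ∈ C^∞`, `∇·u₀ = 0`,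
`∫|u₀|² < ∞`, `∫|∇u₀|² < ∞` (finite energy and enstrophy). [cite: Bachani2026, Thm 7.1 p.9 l.4; abstract p.1 l.10–11] -/
def IsDatum (u₀ : E3 → E3) : Prop :=
  ContDiff ℝ ∞ u₀ ∧ NSWave0.IsDivFree u₀ ∧ (∫⁻ x, ‖u₀ x‖ₑ ^ 2) < ⊤ ∧ (∫⁻ x, ‖fderiv ℝ u₀ x‖ₑ ^ 2) < ⊤

/-- **The class**: a smooth solution of the unforced system on `ℝ³ × [0,T)` from the `H¹` datum
`u₀` with energy bounded on `[0,T)` («smooth solutions … with finite enstrophy», «the corresponding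
Navier–Stokes solution»). [cite: Bachani2026, abstract p.1 l.10–11; §1.1 p.2 l.5–9; Thm 7.1 p.9 l.4–6] -/
structure IsSol (ν : ℝ) (u₀ : E3 → E3) (T : ℝ) (u : ℝ → E3 → E3) (p : ℝ → E3 → ℝ) : Prop where
  datum : IsDatum u₀
  classical : IsClassicalNSSolutionOn (Ico 0 T) ν 0 u p
  initial : u 0 = u₀
  energy : ∃ A : ℝ≥0∞, A < ⊤ ∧ ∀ t ∈ Ico 0 T, ∫⁻ x, ‖u t x‖ₑ ^ 2 ≤ A

/-- «a smooth solution blows up at `T* < ∞`» (Lemma 5.1 p.6 l.4–5; Thm 7.1 proof p.9 l.6):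
`T*` is a maximal time of smoothness — a solution of the class on `[0,T*)` with no classical
extension past `T*` (tree `HasSmoothExtensionPast`). [cite: Bachani2026, Lemma 5.1 p.6 l.4–5; p.9 l.6] -/
def BlowsUp (ν : ℝ) (u₀ : E3 → E3) (T : ℝ) (u : ℝ → E3 → E3) (p : ℝ → E3 → ℝ) : Prop :=
  0 < T ∧ IsSol ν u₀ T u p ∧ ¬ HasSmoothExtensionPast ν 0 u T

/-- «globally smooth»: a classical solution on `ℝ³ × [0,∞)` from `u₀`, energy bounded on every
`[0,T]`. [cite: Bachani2026, Thm 7.1 p.9 l.4–5] -/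
def IsGlobalSol (ν : ℝ) (u₀ : E3 → E3) (u : ℝ → E3 → E3) (p : ℝ → E3 → ℝ) : Prop :=
  IsClassicalNSSolutionOn (Ici 0) ν 0 u p ∧ u 0 = u₀ ∧
    ∀ T : ℝ, 0 < T → ∃ A : ℝ≥0∞, A < ⊤ ∧ ∀ t ∈ Icc 0 T, ∫⁻ x, ‖u t x‖ₑ ^ 2 ≤ A

/-! ## The claimed statement -/

/-- **CLAIMED THEOREM = Theorem 7.1 p.9 l.4–5** «Let u₀ ∈ H¹(ℝ³) be divergence-free. Then the
corresponding Navier-Stokes solution is globally smooth» (smooth sub-face of the datum, see the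
module docstring): for every `ν > 0` and every smooth finite-energy finite-enstrophy divergence-free
datum there is a global smooth solution in the class. POS, (A)-type; STRONGER than Clay (A) on the
data axis (`H¹ ∩ C^∞ ⊋` Fefferman's (4)). [claim: Bachani2026, status: under-review] [cite: Bachani2026, Thm 7.1 p.9 l.4–5; abstract p.1 l.10–11] -/
def ClaimedTheorem : Prop :=
  ∀ ν : ℝ, 0 < ν → ∀ u₀ : E3 → E3, IsDatum u₀ → ∃ (u : ℝ → E3 → E3) (p : ℝ → E3 → ℝ), IsGlobalSol ν u₀ u p

/-! ## The Steps of the printed argument (print order) -/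

/-- **Step 0 — «the corresponding Navier–Stokes solution … suppose for contradiction that blowup
occurs at T* < ∞»** (Thm 7.1 p.9 l.4–6; §1.2 p.2): the maximal smooth solution of the class exists
— either a global solution of the class, or a solution on some `[0,T*)`, `0 < T* < ∞`, that blows
up there. Implicit (local well-posedness + continuation for smooth `H¹` data); typist's flag:
classical. [cite: Bachani2026, Thm 7.1 p.9 l.4–6; §1.2 p.2 l.11–16] -/
def Step0_maximal : Prop :=
  ∀ ν : ℝ, 0 < ν → ∀ u₀ : E3 → E3, IsDatum u₀ →
    (∃ (u : ℝ → E3 → E3) (p : ℝ → E3 → ℝ), IsGlobalSol ν u₀ u p) ∨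
      ∃ (T : ℝ) (u : ℝ → E3 → E3) (p : ℝ → E3 → ℝ), BlowsUp ν u₀ T u p

/-- **Lemma 3.3 (ii) p.4 l.12–13** «Sᵣ(t) = 0 if and only if directions are perfectly aligned
locally almost everywhere»: for a smooth field and `r > 0`, `Sᵣ = 0` iff for a.e. `x` the
directions `ω̂(y)`, `y` in the `r`-neighbourhood of `x` carrying vorticity, coincide. Typist's flag:
SUSPICIOUS (for the relative entropy of Def 3.1 the zero set is «`μ_{r,x}` uniform», and perfect
alignment gives `+∞`). [claim: Bachani2026, status: under-review] [cite: Bachani2026, Lemma 3.3 (ii) p.4 l.12–13] -/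
def Step_L33ii : Prop :=
  ∀ (ρ : Mollifier) (r : ℝ), 0 < r → ∀ w : E3 → E3, ContDiff ℝ ∞ w →
    (globEntropy ρ r w = 0 ↔
      ∀ᵐ x : E3, ∃ v : E3, ∀ y : E3, ρ.ρ r (x - y) ≠ 0 → w y ≠ 0 → dir w y = v)

/-- **Lemma 3.3 (iii) p.4 l.13–14** «Sᵣ(t) is continuous in time for smooth solutions» (real shadow,
on `[0,T)`). [claim: Bachani2026, status: under-review] [cite: Bachani2026, Lemma 3.3 (iii) p.4 l.13–14] -/
def Step_L33iii : Prop :=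
  ∀ (ρ : Mollifier) (r : ℝ), 0 < r →
    ∀ (ν : ℝ) (u₀ : E3 → E3) (T : ℝ) (u : ℝ → E3 → E3) (p : ℝ → E3 → ℝ), IsSol ν u₀ T u p →
      ContinuousOn (fun t => globEntropyR ρ r (curl (u t))) (Ico 0 T)

/-- **Lemma 4.1 (Entropy–Alignment Coercivity) p.5 l.4–7** «There exist constants c₁, c₂ > 0 such
that ℋᵣ(x) ≤ c₁(1 − λ₁(Mᵣ(x)))|log(1 − λ₁)|» (proof: «concentration of measure on S² combined with
the logarithmic Sobolev inequality»; `c₂` does not occur). Typed where `μ_{r,x}` is defined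
(`0 < Wᵣ(x)`), for smooth fields. Typist's flag: SUSPICIOUS (the right side → 0 as `λ₁ → 1` while the
relative entropy of a concentrating measure → +∞). [claim: Bachani2026, status: under-review] [cite: Bachani2026, Lemma 4.1 p.5 l.4–10] -/
def Step_L41 : Prop :=
  ∃ c₁ : ℝ, 0 < c₁ ∧ ∀ (ρ : Mollifier) (r : ℝ), 0 < r → ∀ w : E3 → E3, ContDiff ℝ ∞ w →
    ∀ x : E3, 0 < weight ρ r w x →
      locEntropy ρ r w x ≤ ENNReal.ofReal
        (c₁ * (1 - lam1 (alignTensor ρ r w x)) * |Real.log (1 - lam1 (alignTensor ρ r w x))|)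

/-- A ZONAL direction law on `S²`: a probability density `g(s)`, `s = cos θ ∈ [−1,1]` the cosine
of the polar angle about a fixed axis, with respect to the uniform probability measure on `S²` —
which, by Archimedes' hat-box theorem, is `ds/2` on `[−1,1]` in this variable: `g ≥ 0`,
`½∫_{−1}^{1} g = 1`. [cite: Bachani2026, §2.2 p.3 l.8–11; Def 3.1 p.4 l.5–8] -/
def IsZonalDensity (g : ℝ → ℝ) : Prop :=
  (∀ s, 0 ≤ g s) ∧ IntervalIntegrable g volume (-1) 1 ∧ (1 / 2 : ℝ) * ∫ s in (-1 : ℝ)..1, g s = 1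

/-- Def 3.1 for a zonal law: `ℋ = ∫_{S²} f log(4πf) dn = ½∫_{−1}^{1} g log g ds` (`f = g/(4π)` is the
density w.r.t. surface measure). [cite: Bachani2026, Def 3.1 p.4 l.5–8] -/
def zonalEntropy (g : ℝ → ℝ) : ℝ := (1 / 2 : ℝ) * ∫ s in (-1 : ℝ)..1, g s * Real.log (g s)

/-- `λ₁(M)` for a zonal law: `M = ∫ n⊗n dμ = diag(m⊥, m⊥, m∥)` with `m∥ = ½∫ s² g ds` (axial second
moment) and `m⊥ = ½∫ ((1 − s²)/2) g ds`; `λ₁ = max(m∥, m⊥)`. [cite: Bachani2026, Lemma 4.1 p.5 l.4–7] -/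
def zonalLam1 (g : ℝ → ℝ) : ℝ :=
  max ((1 / 2 : ℝ) * ∫ s in (-1 : ℝ)..1, s ^ 2 * g s)
    ((1 / 2 : ℝ) * ∫ s in (-1 : ℝ)..1, (1 - s ^ 2) / 2 * g s)

/-- **Lemma 4.1, ABSTRACT COMPANION at the grain of its display (cell TYPING-HYGIENE 13), zonal
laws**: the printed inequality `ℋ ≤ c₁(1 − λ₁(M))|log(1 − λ₁)|` read for zonal direction laws on
`S²` (the print states it for the direction measures `μ_{r,x}`, in terms of `∫ n⊗n dμ` and
`∫ f log(4πf)` only; the identification «every zonal law is some `μ_{r,x}`» is NOT typed). Recorded so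
that the display can be read by the kernel without measure theory on the sphere; nothing asserted.
Typist's flag: SUSPICIOUS (cap-uniform laws: `ℋ = log(2/(1 − cos θ)) → ∞` while
`1 − λ₁ = (1 − cos θ)(2 + cos θ)/3 → 0`). [claim: Bachani2026, status: under-review] [cite: Bachani2026, Lemma 4.1 p.5 l.4–10] -/
def Step_L41zonal : Prop :=
  ∃ c₁ : ℝ, 0 < c₁ ∧ ∀ g : ℝ → ℝ, IsZonalDensity g →
    zonalEntropy g ≤ c₁ * (1 - zonalLam1 g) * |Real.log (1 - zonalLam1 g)|

/-- **Corollary 4.2 p.5 l.11** «If A(Mᵣ(x)) → √(2/3) (the maximum anisotropy), then ℋᵣ(x) → 0» —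
along any sequence of (smooth fields, scales, points) at which `μ` is defined. Typist's flag:
suspicious (same inversion as Lemma 4.1). [claim: Bachani2026, status: under-review] [cite: Bachani2026, Cor 4.2 p.5 l.11] -/
def Step_C42 : Prop :=
  ∀ (ρ : Mollifier) (w : ℕ → E3 → E3) (r : ℕ → ℝ) (x : ℕ → E3),
    (∀ n, ContDiff ℝ ∞ (w n) ∧ 0 < r n ∧ 0 < weight ρ (r n) (w n) (x n)) →
    Tendsto (fun n => anis (alignTensor ρ (r n) (w n) (x n))) atTop (𝓝 (Real.sqrt (2 / 3))) →
      Tendsto (fun n => locEntropy ρ (r n) (w n) (x n)) atTop (𝓝 0)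

/-- **Lemma 5.1 (Alignment Collapse under Blowup, «after Constantin–Fefferman») p.6 l.4–7** «If a
smooth solution blows up at T* < ∞, then there exist sequences (xₙ, tₙ, rₙ) with rₙ → 0 such that
A(M_{rₙ}(xₙ,tₙ)) → √(2/3)» (with stage (1) p.6 l.9–10: `tₙ → T*`). Blow-up-conditional. Typist's
flag: suspicious (stages (5)–(6): the CF criterion's contrapositive gives loss of Lipschitz
regularity of `ω̂`, not concentration of `μ_{r,x}`). [claim: Bachani2026, status: under-review] [cite: Bachani2026, Lemma 5.1 p.6 l.4–28] -/
def Step_L51 : Prop :=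
  ∀ (ρ : Mollifier) (ν : ℝ) (u₀ : E3 → E3) (T : ℝ) (u : ℝ → E3 → E3) (p : ℝ → E3 → ℝ),
    BlowsUp ν u₀ T u p →
      ∃ (x : ℕ → E3) (t : ℕ → ℝ) (r : ℕ → ℝ),
        (∀ n, t n ∈ Ico 0 T ∧ 0 < r n ∧ 0 < weight ρ (r n) (curl (u (t n))) (x n)) ∧
        Tendsto t atTop (𝓝 T) ∧ Tendsto r atTop (𝓝 0) ∧
        Tendsto (fun n => anis (alignTensor ρ (r n) (curl (u (t n))) (x n))) atTop
          (𝓝 (Real.sqrt (2 / 3)))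

/-- **Lemma 5.1, stage (1) p.6 l.9–10** «By BKM, blowup implies ∫‖ω‖_∞ dt = ∞, so there exist times
tₙ → T* with ‖ω(·,tₙ)‖_∞ → ∞»: the vorticity of a blowing-up solution of the class is unbounded on
`[0,T*) × ℝ³`. Typist's flag: classical (Beale–Kato–Majda) — in the Beale–Kato–Majda class; the
typed class carries no decay of higher derivatives. [claim: Bachani2026, status: under-review] [cite: Bachani2026, Lemma 5.1 (1) p.6 l.9–10; §1.2 p.2 l.12–13] -/
def Step_L51s1 : Prop :=
  ∀ (ν : ℝ) (u₀ : E3 → E3) (T : ℝ) (u : ℝ → E3 → E3) (p : ℝ → E3 → ℝ), BlowsUp ν u₀ T u p →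
    ∀ M : ℝ, ∃ t ∈ Ico 0 T, ∃ x : E3, M < ‖curl (u t) x‖

/-- **Lemma 5.1, stage (6) p.6 l.17 / l.27–28** «Directional collapse means M → rank-1, hence
A → √(2/3)»: for alignment tensors (symmetric, positive semidefinite, trace one) `λ₁ → 1` forces
`A → √(2/3)`. Linear algebra; typist's flag: TRUE-type. [claim: Bachani2026, status: under-review] [cite: Bachani2026, Lemma 5.1 (6) p.6 l.17, l.27–28] -/
def Step_L51s6 : Prop :=
  ∀ M : ℕ → Matrix (Fin 3) (Fin 3) ℝ,
    (∀ n, (M n).IsSymm ∧ (∀ v : E3, 0 ≤ qform (M n) v) ∧ Matrix.trace (M n) = 1) →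
    Tendsto (fun n => lam1 (M n)) atTop (𝓝 1) →
      Tendsto (fun n => anis (M n)) atTop (𝓝 (Real.sqrt (2 / 3)))

/-- **Proposition 6.1 p.7 l.10–14** «The global entropy evolves as dSᵣ/dt = ν𝒟ᵣ(t) − ℰᵣ(t) where
𝒟ᵣ(t) = ∫|∇ω̂|²|ω|²ρᵣ dx ≥ 0 is the viscous dissipation term and |ℰᵣ(t)| ≤ C r⁻¹∫|ω|² dx bounds the
stretching contribution» («follows from Calderón–Zygmund estimates … combined with mollification at
scale r»; ONE absolute `C`). Typed on the real shadow of `Sᵣ` within `[0,T)`. Typist's flag: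
suspicious (no derivation printed; `C` absolute). [claim: Bachani2026, status: under-review] [cite: Bachani2026, Prop 6.1 p.7 l.10–20] -/
def Step_P61 : Prop :=
  ∃ C : ℝ, 0 < C ∧ ∀ (ρ : Mollifier) (ν : ℝ) (u₀ : E3 → E3) (T : ℝ) (u : ℝ → E3 → E3)
    (p : ℝ → E3 → ℝ), 0 < ν → IsSol ν u₀ T u p → ∀ r : ℝ, 0 < r → ∀ t ∈ Ico 0 T,
      |dSdt ρ r T u t - ν * dissip ρ r (curl (u t))| ≤ C * r⁻¹ * ensq (curl (u t))

/-- **LEMMA 6.2 (Quantitative Entropy Barrier) p.7 l.22–23** «There exist r* > 0 and c* > 0 such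
that if S_{r*}(t) ≤ c*, then dS_{r*}/dt > 0» — for every solution of the class and every time
(`r*`, `c*` may depend on `ν`: Step 4 p.7 l.37–38 «r* < νcε⁻¹/C», «c* := ε»). An a-priori law for
ALL smooth finite-enstrophy solutions. Typist's flag: SUSPICIOUS — the cell's pre-registered
candidate (CARD §4). [claim: Bachani2026, status: under-review] [cite: Bachani2026, Lemma 6.2 p.7 l.22–39, p.8 l.3–4] -/
def Step_L62 : Prop :=
  ∀ (ρ : Mollifier) (ν : ℝ), 0 < ν → ∃ rs cs : ℝ, 0 < rs ∧ 0 < cs ∧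
    ∀ (u₀ : E3 → E3) (T : ℝ) (u : ℝ → E3 → E3) (p : ℝ → E3 → ℝ), IsSol ν u₀ T u p →
      ∀ t ∈ Ico 0 T, St ρ rs u t ≤ ENNReal.ofReal cs → 0 < dSdt ρ rs T u t

/-- **Lemma 6.2, Step 1 p.7 l.25–27** «When ℋᵣ(x) ≤ ε, Lemma 4.1 implies 1 − λ₁(Mᵣ(x)) ≤ Cε/|log ε|»
(ONE `C`; `0 < ε < 1`). Typist's flag: suspicious (Lemma 4.1 bounds `ℋ` from ABOVE by a function
of `1 − λ₁`; an upper bound on `ℋ` does not invert it). [claim: Bachani2026, status: under-review] [cite: Bachani2026, Lemma 6.2 Step 1 p.7 l.25–27] -/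
def Step_L62s1 : Prop :=
  ∃ C : ℝ, 0 < C ∧ ∀ (ρ : Mollifier) (r : ℝ), 0 < r → ∀ w : E3 → E3, ContDiff ℝ ∞ w →
    ∀ (x : E3) (ε : ℝ), 0 < ε → ε < 1 → 0 < weight ρ r w x →
      locEntropy ρ r w x ≤ ENNReal.ofReal ε →
        1 - lam1 (alignTensor ρ r w x) ≤ C * ε / |Real.log ε|

/-- **Lemma 6.2, Step 2 p.7 l.28–33** «Near-alignment implies large angular gradients. When
directions are nearly aligned (λ₁ ≈ 1), maintaining this alignment against advection requires steep
gradients in ω̂. Precisely, on a set of positive measure we have |∇ω̂|² ≥ c r⁻² ε⁻¹» — typed: ONE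
`c > 0`; for every smooth divergence-free finite-enstrophy field, scale `r`, point `x` with
`0 < Wᵣ(x)` and `1 − λ₁(Mᵣ(x)) ≤ ε` (`0 < ε`), the set of `y ∈ B(x,r)` with `|∇ω̂(y)|² ≥ c r⁻² ε⁻¹`
has positive measure. Typist's flag: SUSPICIOUS (a locally constant direction field is perfectly
aligned with `∇ω̂ = 0`). [claim: Bachani2026, status: under-review] [cite: Bachani2026, Lemma 6.2 Step 2 p.7 l.28–33] -/
def Step_L62s2 : Prop :=
  ∃ c : ℝ, 0 < c ∧ ∀ (ρ : Mollifier) (r : ℝ), 0 < r → ∀ v : E3 → E3, ContDiff ℝ ∞ v →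
    NSWave0.IsDivFree v → (∫⁻ y, ‖curl v y‖ₑ ^ 2) < ⊤ →
    ∀ (x : E3) (ε : ℝ), 0 < ε → 0 < weight ρ r (curl v) x →
      1 - lam1 (alignTensor ρ r (curl v) x) ≤ ε →
        0 < volume {y : E3 | y ∈ Metric.ball x r ∧ c * r⁻¹ ^ 2 * ε⁻¹ ≤ dirGradSq (curl v) y}

/-- **Lemma 6.2, Step 3 p.7 l.34–36** «Dissipation dominates. The viscous dissipation term therefore
satisfies 𝒟ᵣ(t) ≥ c r⁻² ε⁻¹ ∫|ω|² dx» (under the low-entropy hypothesis `Sᵣ(t) ≤ ε`; ONE `c`).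
Typist's flag: suspicious. [claim: Bachani2026, status: under-review] [cite: Bachani2026, Lemma 6.2 Step 3 p.7 l.34–36] -/
def Step_L62s3 : Prop :=
  ∃ c : ℝ, 0 < c ∧ ∀ (ρ : Mollifier) (ν : ℝ) (u₀ : E3 → E3) (T : ℝ) (u : ℝ → E3 → E3)
    (p : ℝ → E3 → ℝ), 0 < ν → IsSol ν u₀ T u p → ∀ r : ℝ, 0 < r → ∀ ε : ℝ, 0 < ε → ∀ t ∈ Ico 0 T,
      St ρ r u t ≤ ENNReal.ofReal ε →
        c * r⁻¹ ^ 2 * ε⁻¹ * ensq (curl (u t)) ≤ dissip ρ r (curl (u t))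

/-- **Lemma 6.2, Step 4 p.7 l.37–39** «Choice of barrier scale. Choose r* > 0 such that
ν·c r*⁻²ε⁻¹ > C r*⁻¹, i.e., r* < νcε⁻¹/C. Then for S_{r*}(t) ≤ c* := ε, we have
dS_{r*}/dt = ν𝒟_{r*}(t) − ℰ_{r*}(t) > 0» — the printed inference at the grain of its displayed
quantities: from `𝒟 ≥ c r⁻²ε⁻¹Y`, `|ℰ| ≤ C r⁻¹Y` (`Y = ∫|ω|² ≥ 0`) and `r < νcε⁻¹/C` to
`ν𝒟 − ℰ > 0`. Typist's flag: suspicious (strictness at `Y = 0`). [claim: Bachani2026, status: under-review] [cite: Bachani2026, Lemma 6.2 Step 4 p.7 l.37–39] -/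
def Step_L62s4 : Prop :=
  ∀ (ν c C r ε Y D E : ℝ), 0 < ν → 0 < c → 0 < C → 0 < ε → 0 < r → r < ν * c * ε⁻¹ / C →
    0 ≤ Y → c * r⁻¹ ^ 2 * ε⁻¹ * Y ≤ D → |E| ≤ C * r⁻¹ * Y → 0 < ν * D - E

/-- **Theorem 7.1 proof, line (8) p.9 l.8** «By Corollary 4.2, entropy collapses: Sᵣ(t) → 0 as
t → T*» — typed as the inference the proof uses: for a blowing-up solution of the class, alignment
collapse on vanishing scales (the conclusion of Lemma 5.1) yields `Sᵣ(t) → 0` as `t ↑ T*` at EVERY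
fixed scale `r > 0`. Typist's flag: SUSPICIOUS / LOGIC candidate — Cor 4.2 is pointwise in `x` at
scales `rₙ → 0`; the passage to the global entropy at a fixed scale is not printed.
[claim: Bachani2026, status: under-review] [cite: Bachani2026, Thm 7.1 proof (8) p.9 l.8; Cor 4.2 p.5 l.11] -/
def Step_8 : Prop :=
  ∀ (ρ : Mollifier) (ν : ℝ) (u₀ : E3 → E3) (T : ℝ) (u : ℝ → E3 → E3) (p : ℝ → E3 → ℝ),
    BlowsUp ν u₀ T u p →
      (∃ (x : ℕ → E3) (t : ℕ → ℝ) (r : ℕ → ℝ),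
        (∀ n, t n ∈ Ico 0 T ∧ 0 < r n ∧ 0 < weight ρ (r n) (curl (u (t n))) (x n)) ∧
        Tendsto t atTop (𝓝 T) ∧ Tendsto r atTop (𝓝 0) ∧
        Tendsto (fun n => anis (alignTensor ρ (r n) (curl (u (t n))) (x n))) atTop
          (𝓝 (Real.sqrt (2 / 3)))) →
      ∀ r : ℝ, 0 < r → Tendsto (fun t => St ρ r u t) (𝓝[<] T) (𝓝 0)

/-- **Theorem 7.1 proof, line (9) p.9 l.9** «By Lemma 6.2, Sᵣ(t) ≥ c* > 0 for all t» — the content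
consumed by (10): a uniform positive lower bound for the entropy at the barrier scale along every
solution of the class, at every time. Typist's flag: SUSPICIOUS (Lemma 6.2 is a barrier: it yields
`S_{r*}(t) ≥ min(S_{r*}(0), c*)`, not `≥ c*`, and nothing when `S_{r*}(0) ≤ c*`).
[claim: Bachani2026, status: under-review] [cite: Bachani2026, Thm 7.1 proof (9) p.9 l.9] -/
def Step_9 : Prop :=
  ∀ (ρ : Mollifier) (ν : ℝ), 0 < ν → ∃ rs cs : ℝ, 0 < rs ∧ 0 < cs ∧
    ∀ (u₀ : E3 → E3) (T : ℝ) (u : ℝ → E3 → E3) (p : ℝ → E3 → ℝ), IsSol ν u₀ T u p →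
      ∀ t ∈ Ico 0 T, ENNReal.ofReal cs ≤ St ρ rs u t

/-- **The printed derivation of (9)**: «By Lemma 6.2» (with the continuity Lemma 3.3 (iii)),
`Step_L62 → Step_L33iii → Step_9` — typed as the implication itself. [claim: Bachani2026, status: under-review]
[cite: Bachani2026, Thm 7.1 proof (9) p.9 l.9; Lemma 6.2 p.7–8; Lemma 3.3 (iii) p.4] -/
def Step_9_of_L62 : Prop :=
  Step_L62 → Step_L33iii → Step_9

/-! ## Kernel relations -/

/-- Lemma 3.3 (i) «Sᵣ(t) ≥ 0» holds by construction (relative entropies and weights are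
nonnegative). [cite: Bachani2026, Lemma 3.3 (i) p.4 l.12] -/
theorem lemma33i (ρ : Mollifier) (r : ℝ) (w : E3 → E3) : 0 ≤ globEntropy ρ r w := zero_le

/-- **COMPOSITION (PROVED): the printed chain p.9 l.6–10 closes** — Step 0 (maximal solution),
(7) Lemma 5.1, (8), (9) give Theorem 7.1: in the blow-up branch `S_{r*}(t) → 0` as `t ↑ T*`
contradicts `S_{r*}(t) ≥ c* > 0`. Instantiated at any mollifier (the compositions use
`stdMollifier`). [cite: Bachani2026, Thm 7.1 proof p.9 l.6–10] -/
theorem claim_of_steps_at (ρ : Mollifier) (h0 : Step0_maximal) (h51 : Step_L51) (h8 : Step_8)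
    (h9 : Step_9) : ClaimedTheorem := by
  intro ν hν u₀ hd
  rcases h0 ν hν u₀ hd with hglob | ⟨T, u, p, hblow⟩
  · exact hglob
  · exfalso
    obtain ⟨rs, cs, hrs, hcs, hbar⟩ := h9 ρ ν hν
    have hT : 0 < T := hblow.1
    have hsol : IsSol ν u₀ T u p := hblow.2.1
    -- (7)+(8): `S_{r*}(t) → 0` as `t ↑ T*`
    have hlim : Tendsto (fun t => St ρ rs u t) (𝓝[<] T) (𝓝 0) :=
      h8 ρ ν u₀ T u p hblow (h51 ρ ν u₀ T u p hblow) rs hrs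
    -- eventually `S_{r*}(t) < c*` near `T*` from the left, at some `t ∈ [0,T*)`
    have hcs' : (0 : ℝ≥0∞) < ENNReal.ofReal cs := ENNReal.ofReal_pos.2 hcs
    have hev : ∀ᶠ t in 𝓝[<] T, St ρ rs u t < ENNReal.ofReal cs :=
      hlim (Iio_mem_nhds hcs')
    have hev2 : ∀ᶠ t in 𝓝[<] T, t ∈ Ico (0 : ℝ) T :=
      mem_nhdsWithin.2 ⟨Ioi 0, isOpen_Ioi, hT, fun t ht => ⟨le_of_lt ht.1, ht.2⟩⟩
    obtain ⟨t, ht1, ht2⟩ := (hev.and hev2).exists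
    exact absurd (hbar u₀ T u p hsol t ht2) (not_le.2 ht1)

/-- **COMPOSITION at the standard mollifier.** [cite: Bachani2026, Thm 7.1 proof p.9 l.6–10] -/
theorem claim_of_steps (h0 : Step0_maximal) (h51 : Step_L51) (h8 : Step_8) (h9 : Step_9) :
    ClaimedTheorem :=
  claim_of_steps_at stdMollifier h0 h51 h8 h9

/-- The printed chain with (9) derived as printed. [cite: Bachani2026, Thm 7.1 proof p.9 l.6–10] -/
theorem claim_of_printed_steps (h0 : Step0_maximal) (h51 : Step_L51) (h8 : Step_8)
    (h62 : Step_L62) (h33 : Step_L33iii) (h9i : Step_9_of_L62) : ClaimedTheorem :=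
  claim_of_steps h0 h51 h8 (h9i h62 h33)

/-! ## The Clay link (cell TYPING-HYGIENE 10(a)) -/

/-- A Clay datum (smooth, divergence free, Fefferman's decay (4)) is a smooth `H¹` datum.
[cite: Tao2011, Cor. 11.1 (arXiv:1108.1165)] [cite: FeffermanClay2006, (4) p. 1] -/
theorem isDatum_of_clay {u₀ : E3 → E3} (hsm : ContDiff ℝ ∞ u₀) (hdiv : NSWave0.IsDivFree u₀)
    (hdec : HasRapidSpatialDecay u₀) : IsDatum u₀ := by
  refine ⟨hsm, hdiv, ?_, ?_⟩
  · have h0 := sobolevDatum_of_rapidDecay hdec 0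
    have h2 : ∀ x, ‖iteratedFDeriv ℝ 0 u₀ x‖ₑ = ‖u₀ x‖ₑ := fun x =>
      enorm_eq_iff_norm_eq.2 norm_iteratedFDeriv_zero
    simp_rw [h2] at h0
    exact h0
  · have h1 := sobolevDatum_of_rapidDecay hdec 1
    have h2 : ∀ x, ‖iteratedFDeriv ℝ 1 u₀ x‖ₑ = ‖fderiv ℝ u₀ x‖ₑ := fun x =>
      enorm_eq_iff_norm_eq.2 (norm_iteratedFDeriv_one (f := u₀))
    simp_rw [h2] at h1
    exact h1

/-- **CLAY LINK, PROVED**: the claimed theorem implies Clay (A) (`ClayVariants.clayR3.Regularity`):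
a Clay datum is a smooth `H¹` datum; the global finite-energy classical solution the claim provides
excludes the blow-up branch of the tree's alternative `clayR3_solvable_or_supBlowup` (maximality
among finite-energy classical solutions), so the datum is solvable in the printed class (10)/(7).
Δ-axis recorded: data `H¹ ⊋` (4) (the claim is STRONGER). [cite: Bachani2026, Thm 7.1 p.9] [cite: FeffermanClay2006, (A) p. 2] [cite: Tao2011, Cor. 11.1 (arXiv:1108.1165)] -/
theorem clay_of_claimed (h : ClaimedTheorem) : clayR3.Regularity := by
  intro ν hν u₀ hsm hdiv hdec
  rcases clayR3_solvable_or_supBlowup hν hsm hdiv hdec with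
    hsol | ⟨Ts, hTs, u, p, -, -, -, -, hmax⟩
  · exact hsol
  · exfalso
    obtain ⟨w, q, hcl, hw0, hE⟩ := h ν hν u₀ (isDatum_of_clay hsm hdiv hdec)
    have hclT : IsClassicalNSSolutionOn (Icc 0 Ts) ν 0 w q :=
      hcl.mono Icc_subset_Ici_self (uniqueDiffOn_Icc hTs)
    exact hmax Ts le_rfl w q hclT hw0 (hE Ts hTs)

/-! ## Rev 2 (append-only, typist-7 g6): the TRUE-type linear-algebra stage (6) of Lemma 5.1
DISCHARGED (`step_L51s6_holds`; REF-3 g6 PRE-READ 10:52:00Z K3). Nothing of rev 1 is touched; no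
statement, locator or class input changes; no new `def`. -/

/-! ### Lemma 5.1 stage (6) HOLDS: `λ₁ → 1 ⇒ A → √(2/3)` for alignment tensors (linear algebra) -/

/-- The Frobenius square `Σᵢⱼ Mᵢⱼ²` of a `3 × 3` matrix. [cite: Bachani2026, Cor 4.2 p.5 l.11] -/
def frobSq (M : Matrix (Fin 3) (Fin 3) ℝ) : ℝ := ∑ i, ∑ j, M i j ^ 2

/-- `0 ≤ ‖M‖_F²`. [cite: Bachani2026, Cor 4.2 p.5 l.11] -/
theorem frobSq_nonneg (M : Matrix (Fin 3) (Fin 3) ℝ) : 0 ≤ frobSq M :=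
  Finset.sum_nonneg fun _ _ => Finset.sum_nonneg fun _ _ => sq_nonneg _

/-- `A(M)² = ‖M‖_F² − 1/3` when `tr M = 1`. [cite: Bachani2026, Cor 4.2 p.5 l.11] -/
theorem anis_sq_eq (M : Matrix (Fin 3) (Fin 3) ℝ) (htr : Matrix.trace M = 1) :
    (∑ i, ∑ j, (M i j - (if i = j then (1 / 3 : ℝ) else 0)) ^ 2) = frobSq M - 1 / 3 := by
  rw [Matrix.trace_fin_three] at htr
  simp only [frobSq, Fin.sum_univ_three, Fin.isValue]
  have h01 : ((0 : Fin 3) = 1) = False := by decide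
  have h02 : ((0 : Fin 3) = 2) = False := by decide
  have h10 : ((1 : Fin 3) = 0) = False := by decide
  have h12 : ((1 : Fin 3) = 2) = False := by decide
  have h20 : ((2 : Fin 3) = 0) = False := by decide
  have h21 : ((2 : Fin 3) = 1) = False := by decide
  simp only [h01, h02, h10, h12, h20, h21, if_true, if_false, sub_zero]
  nlinarith [htr]

/-- The quadratic form on an explicit vector. [cite: Bachani2026, Lemma 4.1 p.5 l.4–7] -/
theorem qform_vec (M : Matrix (Fin 3) (Fin 3) ℝ) (a b c : ℝ) :
    qform M !₂[a, b, c] = a * M 0 0 * a + a * M 0 1 * b + a * M 0 2 * c +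
      (b * M 1 0 * a + b * M 1 1 * b + b * M 1 2 * c) +
      (c * M 2 0 * a + c * M 2 1 * b + c * M 2 2 * c) := by
  simp [qform, Fin.sum_univ_three]

/-- Discriminant bound for a nonnegative binary quadratic form. [folklore] -/
private theorem sq_le_mul_of_binary_nonneg {p q r : ℝ}
    (h : ∀ a b : ℝ, 0 ≤ a ^ 2 * p + 2 * a * b * q + b ^ 2 * r) : q ^ 2 ≤ p * r := by
  have hp : 0 ≤ p := by simpa using h 1 0
  have hr : 0 ≤ r := by simpa using h 0 1
  rcases hr.lt_or_eq with hr' | hr'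
  · have h1 := h r (-q)
    nlinarith
  · subst hr'
    have h2 := h (-q) (p + 1)
    have h3 := h q (-(p + 1))
    nlinarith

/-- **`‖M‖_F² ≤ (tr M)² = 1` for a symmetric positive semidefinite alignment tensor** (`Mᵢⱼ² ≤ MᵢᵢMⱼⱼ`
from the `2 × 2` principal minors). [cite: Bachani2026, Lemma 4.1 p.5 l.4–7] -/
theorem frobSq_le_one (M : Matrix (Fin 3) (Fin 3) ℝ) (hsym : M.IsSymm)
    (hpsd : ∀ v : E3, 0 ≤ qform M v) (htr : Matrix.trace M = 1) : frobSq M ≤ 1 := by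
  rw [Matrix.trace_fin_three] at htr
  have s10 : M 1 0 = M 0 1 := hsym.apply 0 1
  have s20 : M 2 0 = M 0 2 := hsym.apply 0 2
  have s21 : M 2 1 = M 1 2 := hsym.apply 1 2
  have h01 : M 0 1 ^ 2 ≤ M 0 0 * M 1 1 := by
    refine sq_le_mul_of_binary_nonneg fun a b => ?_
    have h := hpsd !₂[a, b, 0]
    rw [qform_vec, s10] at h
    nlinarith [h]
  have h02 : M 0 2 ^ 2 ≤ M 0 0 * M 2 2 := by
    refine sq_le_mul_of_binary_nonneg fun a b => ?_
    have h := hpsd !₂[a, 0, b]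
    rw [qform_vec, s20] at h
    nlinarith [h]
  have h12 : M 1 2 ^ 2 ≤ M 1 1 * M 2 2 := by
    refine sq_le_mul_of_binary_nonneg fun a b => ?_
    have h := hpsd !₂[0, a, b]
    rw [qform_vec, s21] at h
    nlinarith [h]
  simp only [frobSq, Fin.sum_univ_three, Fin.isValue]
  rw [s10, s20, s21]
  nlinarith [h01, h02, h12, htr]

/-- **Cauchy–Schwarz: `vᵀMv ≤ ‖M‖_F` for unit `v`.** [cite: Bachani2026, Lemma 4.1 p.5 l.4–7] -/
theorem qform_le_sqrt_frobSq (M : Matrix (Fin 3) (Fin 3) ℝ) (v : E3) (hv : ‖v‖ = 1) :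
    qform M v ≤ Real.sqrt (frobSq M) := by
  have hn : v 0 ^ 2 + v 1 ^ 2 + v 2 ^ 2 = 1 := by
    have h := EuclideanSpace.norm_sq_eq v
    rw [hv, one_pow, Fin.sum_univ_three] at h
    simp only [Real.norm_eq_abs, sq_abs] at h
    linarith
  have hq : qform M v = v 0 * M 0 0 * v 0 + v 0 * M 0 1 * v 1 + v 0 * M 0 2 * v 2 +
      (v 1 * M 1 0 * v 0 + v 1 * M 1 1 * v 1 + v 1 * M 1 2 * v 2) +
      (v 2 * M 2 0 * v 0 + v 2 * M 2 1 * v 1 + v 2 * M 2 2 * v 2) := by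
    simp [qform, Fin.sum_univ_three]
  have hF : frobSq M = M 0 0 ^ 2 + M 0 1 ^ 2 + M 0 2 ^ 2 + (M 1 0 ^ 2 + M 1 1 ^ 2 + M 1 2 ^ 2) +
      (M 2 0 ^ 2 + M 2 1 ^ 2 + M 2 2 ^ 2) := by
    simp [frobSq, Fin.sum_univ_three]
  -- Cauchy–Schwarz over the nine pairs
  have hCS : (qform M v) ^ 2 ≤ frobSq M := by
    have h := Finset.sum_mul_sq_le_sq_mul_sq (Finset.univ : Finset (Fin 3 × Fin 3))
      (fun p => M p.1 p.2) (fun p => v p.1 * v p.2)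
    have e1 : ∑ p : Fin 3 × Fin 3, M p.1 p.2 * (v p.1 * v p.2) = qform M v := by
      rw [hq, Fintype.sum_prod_type]
      simp [Fin.sum_univ_three]
      ring
    have e2 : ∑ p : Fin 3 × Fin 3, (M p.1 p.2) ^ 2 = frobSq M := by
      rw [hF, Fintype.sum_prod_type]
      simp [Fin.sum_univ_three]
    have e3 : ∑ p : Fin 3 × Fin 3, (v p.1 * v p.2) ^ 2 = 1 := by
      rw [Fintype.sum_prod_type]
      simp only [Fin.sum_univ_three, Fin.isValue]
      nlinarith [hn]
    rw [e1, e2, e3, mul_one] at h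
    exact h
  exact (le_abs_self _).trans (Real.abs_le_sqrt hCS)

/-- `λ₁(M) ≤ ‖M‖_F`. [cite: Bachani2026, Lemma 4.1 p.5 l.7] -/
theorem lam1_le_sqrt_frobSq (M : Matrix (Fin 3) (Fin 3) ℝ) : lam1 M ≤ Real.sqrt (frobSq M) := by
  unfold lam1
  refine Real.iSup_le (fun v => qform_le_sqrt_frobSq M v ?_) (Real.sqrt_nonneg _)
  exact mem_sphere_zero_iff_norm.1 v.2

/-- **Lemma 5.1 stage (6) p.6 l.17 HOLDS** («Directional collapse means M → rank-1, hence
A → √(2/3)»): along any sequence of symmetric positive semidefinite trace-one matrices with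
`λ₁ → 1`, `A = ‖M − I/3‖_F → √(2/3)` — since `λ₁² ≤ ‖M‖_F² ≤ 1` and `A² = ‖M‖_F² − 1/3`.
[cite: Bachani2026, Lemma 5.1 (6) p.6 l.17, l.27–28; Cor 4.2 p.5 l.11] -/
theorem step_L51s6_holds : Step_L51s6 := by
  intro M hM hlam
  have hA : ∀ n, anis (M n) = Real.sqrt (frobSq (M n) - 1 / 3) := fun n => by
    unfold anis
    rw [anis_sq_eq _ (hM n).2.2]
  have hup : ∀ n, frobSq (M n) ≤ 1 := fun n => frobSq_le_one _ (hM n).1 (hM n).2.1 (hM n).2.2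
  have hf : Tendsto (fun n => frobSq (M n)) atTop (𝓝 1) := by
    have hsq : Tendsto (fun n => lam1 (M n) ^ 2) atTop (𝓝 1) := by
      simpa using hlam.pow 2
    refine tendsto_of_tendsto_of_tendsto_of_le_of_le' hsq tendsto_const_nhds ?_
      (Eventually.of_forall hup)
    have hev : ∀ᶠ n in atTop, 0 ≤ lam1 (M n) := hlam.eventually (eventually_ge_nhds one_pos)
    filter_upwards [hev] with n hn
    calc lam1 (M n) ^ 2 ≤ Real.sqrt (frobSq (M n)) ^ 2 :=
          pow_le_pow_left₀ hn (lam1_le_sqrt_frobSq _) 2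
      _ = frobSq (M n) := Real.sq_sqrt (frobSq_nonneg _)
  have hlim : Tendsto (fun n => Real.sqrt (frobSq (M n) - 1 / 3)) atTop (𝓝 (Real.sqrt (2 / 3))) := by
    have h := (hf.sub_const (1 / 3)).sqrt
    have e : (1 : ℝ) - 1 / 3 = 2 / 3 := by norm_num
    rw [e] at h
    exact h
  refine hlim.congr fun n => (hA n).symm

end Literature.Claims.NS.Bachani2026

end

-- WHAT THIS IS NOT: not a claim about NS regularity or blow-up; not a claim about any author beyond the
-- typed locator.
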